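import Summits.NavierStokesRegularity.NavierStokesRegularity.Theorems.ThreadingFluxCentreVirialBallFluxTools
import HarnessLib

/-!
# Sphere-free Gauss–Green on a ball and a shell, for radial weights
# (crux `PoloidalLiouville`, stmt-NavierStokesRegularity-1222, W1; crux idea «centre-virial», ns-idea-15 g9)

`ball_shell_flux`: for `V ∈ C¹(ℝ³; ℝ³)`, a centre `x₀`, radii `0 ≤ a < b` and EVERY continuous density `ζ` of the squared radius,

  `(∫_{a²}^{b²} ζ) · ∫_{|y| ≤ a} div V + ∫_{a < |y| ≤ b} (∫_{|y|²}^{b²} ζ) · div V = 2 ∫_{a < |y| ≤ b} ζ(|y|²) ⟪V, y⟫`.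

This is `∫ K(|y|²) div V = −2 ∫ K′(|y|²) ⟪V, y⟫` for the KINKED profile `K(σ) = ∫_{max σ a²}^{b²} ζ` (constant on the inner
ball, zero outside), obtained from the smooth identity `integral_radialProfile_mul_divergence` applied to
`K_n(σ) = ∫_σ^{b²+1} ζ·trap_n` and two dominated-convergence passages (`trap_n →` indicator of `(a², b²]` pointwise).
With `ζ ≡ 1` it is the divergence theorem on balls in flux-free form; with `ζ = shellDensity (a²)` it is the shell identity
of the centre-virial flux profile (`ThreadingFluxCentreVirialFluxProfile.lean`).  Folklore analysis; nothing here refers to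
Navier–Stokes; NS regularity is NOT proved.  `--supports stmt-NavierStokesRegularity-1222 --as helper`.
Filed by ns-wall-eng-4 g6 (cell ns-wall-extremal). [cite: Leray1934, §6 (1.11) p. 203]
-/

-- the summit and its single sub-problem share the name (CONVENTIONS §1)
set_option linter.dupNamespace false

noncomputable section

namespace Summit.NavierStokesRegularity.NavierStokesRegularity.Theorems.PoloidalLiouville.CentreVirial

open Set Function MeasureTheory Filter Topology
open Literature.Analysis.FluidPDE
open Literature.Analysis.FluidPDE.VectorCalculus (divergence)
open Summit.NavierStokesRegularity.NavierStokesRegularity.Theorems.PoloidalLiouville.CentreJet (E3)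
open scoped RealInnerProductSpace

/-- **Sphere-free Gauss–Green on a ball and a shell, for radial weights** (the workhorse of the centre-virial line).
For `V ∈ C¹(ℝ³; ℝ³)`, a centre `x₀`, radii `0 ≤ a < b` and a continuous density `ζ` of the squared radius:
`(∫_{a²}^{b²} ζ) · ∫_{|y| ≤ a} div V + ∫_{a < |y| ≤ b} (∫_{|y|²}^{b²} ζ) · div V = 2 ∫_{a < |y| ≤ b} ζ(|y|²) ⟪V, y⟫`.
This is `∫ K(|y|²) div V = −2∫ K′(|y|²)⟪V, y⟫` for the KINKED profile `K(σ) = ∫_{max σ a²}^{b²} ζ` (constant on the inner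
ball, zero outside), obtained from the smooth case (`integral_radialProfile_mul_divergence`) applied to
`K_n(σ) = ∫_σ^{b²+1} ζ · trap_n` and dominated convergence on both sides (`trap_n →` indicator of `(a², b²]` pointwise,
eventually constant at every point).  With `ζ ≡ 1` it is the divergence theorem on balls in flux-free form; with
`ζ(τ) = (3/2) τ^{-5/2}` it is the shell identity of the flux profile. -/
theorem ball_shell_flux {V : E3 → E3} (hV : ContDiff ℝ 1 V) (x₀ : E3) {ζ : ℝ → ℝ} (hζ : Continuous ζ)
    {a b : ℝ} (ha : 0 ≤ a) (hab : a < b) :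
    (∫ τ in (a ^ 2)..(b ^ 2), ζ τ) * (∫ x in Metric.closedBall x₀ a, divergence V x) +
      ∫ x in {x | a < ‖x - x₀‖ ∧ ‖x - x₀‖ ≤ b}, (∫ τ in (‖x - x₀‖ ^ 2)..(b ^ 2), ζ τ) * divergence V x =
    2 * ∫ x in {x | a < ‖x - x₀‖ ∧ ‖x - x₀‖ ≤ b}, ζ (‖x - x₀‖ ^ 2) * ⟪V x, x - x₀⟫ := by
  set α : ℝ := a ^ 2 with hα_def
  set β : ℝ := b ^ 2 with hβ_def
  have hb : 0 < b := lt_of_le_of_lt ha hab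
  have hαβ : α < β := by rw [hα_def, hβ_def]; exact pow_lt_pow_left₀ hab ha two_ne_zero
  have hβ0 : 0 < β := by positivity
  set T : Set E3 := {x | a < ‖x - x₀‖ ∧ ‖x - x₀‖ ≤ b} with hT_def
  have hTm : MeasurableSet T := by
    have : T = Metric.closedBall x₀ b \ Metric.closedBall x₀ a := by
      ext x; simp [hT_def, Metric.mem_closedBall, dist_eq_norm, and_comm]
    rw [this]
    exact Metric.isClosed_closedBall.measurableSet.diff Metric.isClosed_closedBall.measurableSet
  -- membership in `T` / the inner ball through the squared radius
  have hmemT : ∀ x : E3, x ∈ T ↔ ‖x - x₀‖ ^ 2 ∈ Set.Ioc α β := by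
    intro x
    rw [hT_def, Set.mem_setOf_eq, Set.mem_Ioc, hα_def, hβ_def,
      pow_lt_pow_iff_left₀ ha (norm_nonneg _) two_ne_zero, pow_le_pow_iff_left₀ (norm_nonneg _) hb.le two_ne_zero]
  have hmemB : ∀ x : E3, x ∈ Metric.closedBall x₀ a ↔ ‖x - x₀‖ ^ 2 ≤ α := by
    intro x
    rw [Metric.mem_closedBall, dist_eq_norm, hα_def, pow_le_pow_iff_left₀ (norm_nonneg _) ha two_ne_zero]
  -- the approximating smooth profiles
  set g : ℕ → ℝ → ℝ := fun n τ => ζ τ * trap α β n τ with hg_def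
  have hg : ∀ n, Continuous (g n) := fun n => hζ.mul (continuous_trap α β n)
  set κ : ℕ → ℝ → ℝ := fun n σ => ∫ τ in σ..(β + 1), g n τ with hκ_def
  have hκd : ∀ n σ, HasDerivAt (κ n) (-(g n σ)) σ := fun n σ =>
    intervalIntegral.integral_hasDerivAt_left ((hg n).intervalIntegrable _ _)
      ((hg n).stronglyMeasurableAtFilter _ _) (hg n).continuousAt
  have hκderiv : ∀ n, deriv (κ n) = fun σ => -(g n σ) := fun n => funext fun σ => (hκd n σ).deriv
  have hκC : ∀ n, ContDiff ℝ 1 (κ n) := fun n =>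
    contDiff_one_iff_deriv.2 ⟨fun σ => (hκd n σ).differentiableAt, by rw [hκderiv n]; exact (hg n).neg⟩
  -- `κ n` vanishes beyond `β + 1/(n+1)`, in particular beyond `β + 1`
  have hκ0' : ∀ (n : ℕ) (σ : ℝ), β + 1 / ((n : ℝ) + 1) ≤ σ → κ n σ = 0 := by
    intro n σ hσ
    show ∫ τ in σ..(β + 1), g n τ = 0
    rw [intervalIntegral.integral_congr (g := fun _ => (0 : ℝ)), intervalIntegral.integral_zero]
    intro τ hτ
    have hτ' : β + 1 / ((n : ℝ) + 1) ≤ τ := by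
      rcases le_total σ (β + 1) with h | h
      · rw [Set.uIcc_of_le h] at hτ; exact hσ.trans hτ.1
      · rw [Set.uIcc_of_ge h] at hτ
        have h1 : 1 / ((n : ℝ) + 1) ≤ 1 := by
          rw [div_le_one (by positivity)]; have : (0 : ℝ) ≤ n := Nat.cast_nonneg n; linarith
        linarith [hτ.1]
    show ζ τ * trap α β n τ = 0
    rw [trap_eq_zero_of_ge n hτ', mul_zero]
  have hκ0 : ∀ (n : ℕ) (σ : ℝ), β + 1 ≤ σ → κ n σ = 0 := by
    intro n σ hσ
    refine hκ0' n σ (le_trans ?_ hσ)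
    have h1 : 1 / ((n : ℝ) + 1) ≤ 1 := by
      rw [div_le_one (by positivity)]; have : (0 : ℝ) ≤ n := Nat.cast_nonneg n; linarith
    linarith
  -- the smooth identities
  have hE : ∀ n : ℕ, ∫ x, κ n (‖x - x₀‖ ^ 2) * divergence V x =
      2 * ∫ x, g n (‖x - x₀‖ ^ 2) * ⟪V x, x - x₀⟫ := by
    intro n
    rw [integral_radialProfile_mul_divergence hV x₀ (hκC n) (hκ0 n), hκderiv n]
    simp only [neg_mul, integral_neg]
    ring
  -- uniform bound on the profiles
  set bnd : ℝ → ℝ := (Set.Icc α (β + 1)).indicator fun τ => |ζ τ| with hbnd_def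
  have hbnd_int : Integrable bnd :=
    ((hζ.abs.continuousOn).integrableOn_compact isCompact_Icc).integrable_indicator measurableSet_Icc
  have hg_le : ∀ n τ, ‖g n τ‖ ≤ bnd τ := by
    intro n τ
    by_cases hτ : τ ∈ Set.Icc α (β + 1)
    · rw [hbnd_def, Set.indicator_of_mem hτ, Real.norm_eq_abs, hg_def]
      dsimp only
      rw [abs_mul, abs_of_nonneg (trap_nonneg α β n τ)]
      exact mul_le_of_le_one_right (abs_nonneg _) (trap_le_one α β n τ)
    · rw [hbnd_def, Set.indicator_of_notMem hτ, Real.norm_eq_abs, hg_def]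
      dsimp only
      rw [Set.mem_Icc, not_and_or, not_le, not_le] at hτ
      rcases hτ with hτ | hτ
      · rw [trap_eq_zero_of_le n hτ.le, mul_zero, abs_zero]
      · rw [trap_eq_zero_of_ge_add_one n hτ.le, mul_zero, abs_zero]
  have hg_int : ∀ n, Integrable (g n) := fun n =>
    hbnd_int.mono' (hg n).aestronglyMeasurable (Eventually.of_forall (hg_le n))
  set C : ℝ := ∫ τ, bnd τ with hC_def
  have hκ_le : ∀ n σ, |κ n σ| ≤ C := by
    intro n σ
    calc |κ n σ| = ‖∫ τ in σ..(β + 1), g n τ‖ := (Real.norm_eq_abs _).symm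
      _ ≤ ∫ τ in Set.uIoc σ (β + 1), ‖g n τ‖ := intervalIntegral.norm_integral_le_integral_norm_uIoc
      _ ≤ ∫ τ, ‖g n τ‖ := setIntegral_le_integral (hg_int n).norm (Eventually.of_forall fun τ => norm_nonneg _)
      _ ≤ ∫ τ, bnd τ := integral_mono (hg_int n).norm hbnd_int (hg_le n)
  -- a radius beyond which everything vanishes
  set R : ℝ := β + 2 with hR_def
  have hfar : ∀ x : E3, x ∉ Metric.closedBall x₀ R → β + 1 ≤ ‖x - x₀‖ ^ 2 := by
    intro x hx
    rw [Metric.mem_closedBall, dist_eq_norm, not_le] at hx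
    have h1 : 1 ≤ ‖x - x₀‖ := by linarith
    nlinarith
  -- continuity of the data
  have hdivc : Continuous (divergence V) := continuous_divergence (hV.continuous_fderiv one_ne_zero)
  have hinc : Continuous fun x : E3 => ⟪V x, x - x₀⟫ := hV.continuous.inner (continuous_id.sub continuous_const)
  have hnsq : Continuous fun x : E3 => ‖x - x₀‖ ^ 2 := (continuous_norm.comp (continuous_id.sub continuous_const)).pow 2
  -- LHS: dominated convergence
  set L : E3 → ℝ := fun x => (Metric.closedBall x₀ a).indicator (fun _ => ∫ τ in α..β, ζ τ) x +
      T.indicator (fun x => ∫ τ in (‖x - x₀‖ ^ 2)..β, ζ τ) x with hL_def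
  have hLlim : ∀ x : E3, Tendsto (fun n : ℕ => κ n (‖x - x₀‖ ^ 2)) atTop (𝓝 (L x)) := by
    intro x
    set σ := ‖x - x₀‖ ^ 2 with hσ_def
    rcases le_or_gt σ β with hσ | hσ
    · -- inside the big ball: interval dominated convergence
      have h := tendsto_integral_mul_trap hζ hαβ.le hσ
      have hL : L x = ∫ τ in (max σ α)..β, ζ τ := by
        rcases le_or_gt σ α with hσα | hσα
        · have hxB : x ∈ Metric.closedBall x₀ a := (hmemB x).2 hσα
          have hxT : x ∉ T := fun hx => (not_lt.2 hσα) ((hmemT x).1 hx).1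
          rw [hL_def]; dsimp only
          rw [Set.indicator_of_mem hxB, Set.indicator_of_notMem hxT, add_zero, max_eq_right hσα]
        · have hxB : x ∉ Metric.closedBall x₀ a := fun hx => (not_le.2 hσα) ((hmemB x).1 hx)
          have hxT : x ∈ T := (hmemT x).2 ⟨hσα, hσ⟩
          rw [hL_def]; dsimp only
          rw [Set.indicator_of_notMem hxB, Set.indicator_of_mem hxT, zero_add, max_eq_left hσα.le]
      rw [hL]
      exact h
    · -- outside: eventually zero
      have hxB : x ∉ Metric.closedBall x₀ a := fun hx => by
        have := (hmemB x).1 hx; linarith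
      have hxT : x ∉ T := fun hx => (not_le.2 hσ) ((hmemT x).1 hx).2
      have hL : L x = 0 := by
        rw [hL_def]; dsimp only
        rw [Set.indicator_of_notMem hxB, Set.indicator_of_notMem hxT, add_zero]
      rw [hL]
      obtain ⟨N, hN⟩ := exists_nat_gt (1 / (σ - β))
      refine tendsto_const_nhds.congr' (Filter.eventually_atTop.2 ⟨N, fun n hn => (hκ0' n σ ?_).symm⟩)
      have hσβ : 0 < σ - β := by linarith
      have hn' : (N : ℝ) < (n : ℝ) + 1 := by
        have : (N : ℝ) ≤ n := by exact_mod_cast hn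
        linarith
      have h1 : 1 / ((n : ℝ) + 1) < σ - β := by
        rw [div_lt_iff₀ (by positivity)]
        have h2 : 1 / (σ - β) * (σ - β) = 1 := by field_simp
        nlinarith
      linarith
  have hLHS : Tendsto (fun n : ℕ => ∫ x, κ n (‖x - x₀‖ ^ 2) * divergence V x) atTop
      (𝓝 (∫ x, L x * divergence V x)) := by
    refine tendsto_integral_of_dominated_convergence
      (fun x => (Metric.closedBall x₀ R).indicator (fun x => C * |divergence V x|) x) ?_ ?_ ?_ ?_
    · intro n
      exact (((hκC n).continuous.comp hnsq).mul hdivc).aestronglyMeasurable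
    · exact ((continuous_const.mul hdivc.abs).continuousOn.integrableOn_compact
        (isCompact_closedBall x₀ R)).integrable_indicator Metric.isClosed_closedBall.measurableSet
    · intro n
      refine Eventually.of_forall fun x => ?_
      by_cases hx : x ∈ Metric.closedBall x₀ R
      · rw [Set.indicator_of_mem hx, Real.norm_eq_abs, abs_mul]
        exact mul_le_mul_of_nonneg_right (hκ_le n _) (abs_nonneg _)
      · rw [Set.indicator_of_notMem hx, Real.norm_eq_abs, hκ0 n _ (hfar x hx), zero_mul, abs_zero]
    · exact Eventually.of_forall fun x => (hLlim x).mul_const _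
  -- RHS: dominated convergence
  have hRHS : Tendsto (fun n : ℕ => ∫ x, g n (‖x - x₀‖ ^ 2) * ⟪V x, x - x₀⟫) atTop
      (𝓝 (∫ x, T.indicator (fun x => ζ (‖x - x₀‖ ^ 2) * ⟪V x, x - x₀⟫) x)) := by
    refine tendsto_integral_of_dominated_convergence
      (fun x => (Metric.closedBall x₀ R).indicator (fun x => |ζ (‖x - x₀‖ ^ 2)| * |⟪V x, x - x₀⟫|) x) ?_ ?_ ?_ ?_
    · intro n
      exact (((hg n).comp hnsq).mul hinc).aestronglyMeasurable
    · exact (((hζ.comp hnsq).abs.mul hinc.abs).continuousOn.integrableOn_compact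
        (isCompact_closedBall x₀ R)).integrable_indicator Metric.isClosed_closedBall.measurableSet
    · intro n
      refine Eventually.of_forall fun x => ?_
      by_cases hx : x ∈ Metric.closedBall x₀ R
      · rw [Set.indicator_of_mem hx, Real.norm_eq_abs, abs_mul, hg_def]
        dsimp only
        rw [abs_mul, abs_of_nonneg (trap_nonneg _ _ _ _)]
        exact mul_le_mul_of_nonneg_right (mul_le_of_le_one_right (abs_nonneg _) (trap_le_one _ _ _ _))
          (abs_nonneg _)
      · rw [Set.indicator_of_notMem hx, Real.norm_eq_abs, hg_def]
        dsimp only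
        rw [trap_eq_zero_of_ge_add_one n (hfar x hx), mul_zero, zero_mul, abs_zero]
    · refine Eventually.of_forall fun x => ?_
      have h := ((tendsto_trap α β (‖x - x₀‖ ^ 2)).const_mul (ζ (‖x - x₀‖ ^ 2))).mul_const ⟪V x, x - x₀⟫
      refine h.congr' (Eventually.of_forall fun n => rfl) |>.trans ?_
      by_cases hx : x ∈ T
      · rw [Set.indicator_of_mem hx, Set.indicator_of_mem ((hmemT x).1 hx), mul_one]
      · have hx' : ‖x - x₀‖ ^ 2 ∉ Set.Ioc α β := fun h => hx ((hmemT x).2 h)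
        rw [Set.indicator_of_notMem hx, Set.indicator_of_notMem hx', mul_zero, zero_mul]
  -- identify the limits
  have hlim_eq : ∫ x, L x * divergence V x = 2 * ∫ x, T.indicator (fun x => ζ (‖x - x₀‖ ^ 2) * ⟪V x, x - x₀⟫) x := by
    have h2 := hRHS.const_mul 2
    have h1 : Tendsto (fun n : ℕ => ∫ x, κ n (‖x - x₀‖ ^ 2) * divergence V x) atTop
        (𝓝 (2 * ∫ x, T.indicator (fun x => ζ (‖x - x₀‖ ^ 2) * ⟪V x, x - x₀⟫) x)) :=
      h2.congr fun n => (hE n).symm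
    exact tendsto_nhds_unique hLHS h1
  rw [integral_indicator hTm] at hlim_eq
  rw [← hlim_eq]
  -- unfold the limit profile
  have hI1 : Integrable fun x => (Metric.closedBall x₀ a).indicator (fun _ => ∫ τ in α..β, ζ τ) x * divergence V x := by
    have : (fun x => (Metric.closedBall x₀ a).indicator (fun _ => ∫ τ in α..β, ζ τ) x * divergence V x) =
        (Metric.closedBall x₀ a).indicator (fun x => (∫ τ in α..β, ζ τ) * divergence V x) := by
      funext x; by_cases hx : x ∈ Metric.closedBall x₀ a
      · rw [Set.indicator_of_mem hx, Set.indicator_of_mem hx]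
      · rw [Set.indicator_of_notMem hx, Set.indicator_of_notMem hx, zero_mul]
    rw [this]
    exact ((continuous_const.mul hdivc).continuousOn.integrableOn_compact (isCompact_closedBall x₀ a)).integrable_indicator
      Metric.isClosed_closedBall.measurableSet
  have hcontI : Continuous fun x : E3 => ∫ τ in (‖x - x₀‖ ^ 2)..β, ζ τ := by
    have h1 : Continuous fun σ : ℝ => ∫ τ in σ..β, ζ τ := by
      have : (fun σ : ℝ => ∫ τ in σ..β, ζ τ) = fun σ => -∫ τ in β..σ, ζ τ := by
        funext σ; rw [intervalIntegral.integral_symm]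
      rw [this]
      exact (intervalIntegral.continuous_primitive (fun _ _ => hζ.intervalIntegrable _ _) β).neg
    exact h1.comp hnsq
  have hI2 : Integrable fun x => T.indicator (fun x => ∫ τ in (‖x - x₀‖ ^ 2)..β, ζ τ) x * divergence V x := by
    have : (fun x => T.indicator (fun x => ∫ τ in (‖x - x₀‖ ^ 2)..β, ζ τ) x * divergence V x) =
        T.indicator (fun x => (∫ τ in (‖x - x₀‖ ^ 2)..β, ζ τ) * divergence V x) := by
      funext x; by_cases hx : x ∈ T
      · rw [Set.indicator_of_mem hx, Set.indicator_of_mem hx]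
      · rw [Set.indicator_of_notMem hx, Set.indicator_of_notMem hx, zero_mul]
    rw [this]
    refine (((hcontI.mul hdivc).continuousOn.integrableOn_compact (isCompact_closedBall x₀ b)).mono_set ?_).integrable_indicator hTm
    intro x hx
    rw [Metric.mem_closedBall, dist_eq_norm]
    exact hx.2
  have hsplit : ∫ x, L x * divergence V x =
      (∫ x, (Metric.closedBall x₀ a).indicator (fun _ => ∫ τ in α..β, ζ τ) x * divergence V x) +
        ∫ x, T.indicator (fun x => ∫ τ in (‖x - x₀‖ ^ 2)..β, ζ τ) x * divergence V x := by
    rw [← integral_add hI1 hI2]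
    refine integral_congr_ae (Eventually.of_forall fun x => ?_)
    show L x * divergence V x = _
    rw [hL_def]; dsimp only
    ring
  rw [hsplit]
  congr 1
  · have : (fun x => (Metric.closedBall x₀ a).indicator (fun _ => ∫ τ in α..β, ζ τ) x * divergence V x) =
        (Metric.closedBall x₀ a).indicator (fun x => (∫ τ in α..β, ζ τ) * divergence V x) := by
      funext x; by_cases hx : x ∈ Metric.closedBall x₀ a
      · rw [Set.indicator_of_mem hx, Set.indicator_of_mem hx]
      · rw [Set.indicator_of_notMem hx, Set.indicator_of_notMem hx, zero_mul]
    rw [this, integral_indicator Metric.isClosed_closedBall.measurableSet, integral_const_mul]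
  · have : (fun x => T.indicator (fun x => ∫ τ in (‖x - x₀‖ ^ 2)..β, ζ τ) x * divergence V x) =
        T.indicator (fun x => (∫ τ in (‖x - x₀‖ ^ 2)..β, ζ τ) * divergence V x) := by
      funext x; by_cases hx : x ∈ T
      · rw [Set.indicator_of_mem hx, Set.indicator_of_mem hx]
      · rw [Set.indicator_of_notMem hx, Set.indicator_of_notMem hx, zero_mul]
    rw [this, integral_indicator hTm]

end Summit.NavierStokesRegularity.NavierStokesRegularity.Theorems.PoloidalLiouville.CentreVirial
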